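import Mathlib
import Summits.PneNP.PneNP.Theorems.PstarXCore
import Summits.PneNP.PneNP.Theorems.PstarLinearisationFP
import Summits.PneNP.PneNP.Theorems.PstarSASDPLevel

/-!
# Obstruction: a linearisable pure `P⋆` instance is never boundary expanding above ratio `1` (ROUND-24 calibration, negative half)

FRONTIER range-avoidance ladder, ROUND-24 (cell `pnp-ideate`; restricted-model combinatorics — nothing here bears on `P` versus
`NP`).  The boundary of the expansion METHOD behind the cell's Sherali–Adams blindness theorems, as a kernel lemma.

**Theorem** (`linearisable_not_boundaryExpandingQ`).  Let `I : LocalMap 4 n m` be a pure `P⋆` instance in the LINEARISABLE class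
`PstarLinearisation.LinearisablePstar` (`n + #{distinct AND pairs} < m` — range avoidance in FP by `pstarLinearisable_localAvoidLinearFP`).
Then for every ratio `a/b > 1` and every radius `r ≥ 4b + 2`, `I` is NOT `(r, a/b)`-boundary expanding:
`¬ PstarSASDPLevel.BoundaryExpandingQ a b r I`.  Since the hub `PairwiseSALevel.PairwiseSALinearLevel` (and every SA-blindness
theorem of ROUNDS 21–23) needs ratio `a/b > k − 3 = 1`, no expansion-based SA lower bound can ever be instantiated on an FP-easy
linearisable instance beyond constant radius: the honest calibration «SA-blind yet easy» is available at level `2` only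
(`PstarLinearisableSA2.linearisable_sa2Blind`), and a linear-level version needs a different mechanism (ROUND-24 memo §6, T24.4″).

**Proof.**  Let `R` be the outputs whose AND pair is shared with another output; the AND-pair map is injective off `R`, so
`|R| ≥ m − numAndPairs > n ≥ |xverts R|`.  By peeling (`PstarXCore.exists_leafless`) `R` contains a nonempty LEAFLESS set `K` of the
XOR multigraph, and the greedy walk (`PstarXCore.path_or_small_leafless`) yields inside `K` either a simple `x`-path `S` with `2b+1`
edges or a nonempty leafless `S` with `≤ 2b+1` outputs.  Put `J := S ∪ σ(S)`, `σ` choosing for each `j ∈ S` a twin with the same AND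
pair, `t := |J ∖ S| ≤ |S|`.  Every AND-read variable of `J` is read by two outputs of `J`, so `bdry J` consists of `x`-leaves of `S`
and of XOR vertices of `J ∖ S`: `|bdry J| ≤ #leaves(S) + 2t` with `#leaves(S) ≤ 2` (path) or `= 0` (leafless).  With `a ≥ b + 1`:
path case `b(2 + 2t) < (b+1)(2b+1+t)`, leafless case `2bt < (b+1)(|S| + t)`; and `|J| ≤ 4b + 2 ≤ r`.  (Cell record: obstruction found
by prover-1, independently by p3 (twin 3-paths), hand-checked by the referee, 2026-08-28.)
-/

set_option linter.dupNamespace false -- `Summit.PneNP.PneNP.…`: summit = sub-problem name (D-0017 single-conjunct layout)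

open Finset Literature.Computability.Complexity
open Summit.PneNP.PneNP.Theorems.PstarSALevel (varSet bdry)
open Summit.PneNP.PneNP.Theorems.PstarSASDPLevel (BoundaryExpandingQ)
open Summit.PneNP.PneNP.Theorems.PstarLinearisation (andEdge numAndPairs LinearisablePstar)
open Summit.PneNP.PneNP.Theorems.PstarXCore

namespace Summit.PneNP.PneNP.Theorems.PstarLinearisableNotExpanding

variable {n m : ℕ} (I : LocalMap 4 n m)

/-! ## Repeated AND pairs and twins -/

/-- The outputs whose AND pair is shared with another output. -/
def repeated : Finset (Fin m) := univ.filter fun j => ∃ j', j' ≠ j ∧ andEdge I j' = andEdge I j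

/-- **Counting**: a linearisable instance has more than `n` outputs with a repeated AND pair (the AND-pair map is injective on
the other outputs). -/
theorem lt_card_repeated (hL : LinearisablePstar I) : n < (repeated I).card := by
  classical
  have hU : (univ \ repeated I).card ≤ numAndPairs I := by
    unfold PstarLinearisation.numAndPairs
    refine le_trans ?_ (card_le_card (image_subset_image (subset_univ (univ \ repeated I))))
    rw [card_image_of_injOn]
    intro j hj j' hj' h
    rw [mem_coe, mem_sdiff] at hj
    by_contra hne
    exact hj.2 (mem_filter.2 ⟨mem_univ _, j', Ne.symm hne, h.symm⟩)
  have h1 : (univ \ repeated I).card + (repeated I).card = m := by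
    rw [card_sdiff_add_card_eq_card (subset_univ _), card_univ, Fintype.card_fin]
  have h2 := hL.2
  omega

/-- A member of `repeated I` has a twin. -/
theorem exists_twin {j : Fin m} (hj : j ∈ repeated I) : ∃ j', j' ≠ j ∧ andEdge I j' = andEdge I j := (mem_filter.1 hj).2

/-- A twin map (arbitrary off `repeated I`). -/
noncomputable def twinOf (j : Fin m) : Fin m :=
  if h : j ∈ repeated I then Classical.choose (exists_twin I h) else j

/-- The twin is another output with the same AND pair. -/
theorem twinOf_spec {j : Fin m} (hj : j ∈ repeated I) : twinOf I j ≠ j ∧ andEdge I (twinOf I j) = andEdge I j := by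
  unfold twinOf
  rw [dif_pos hj]
  exact Classical.choose_spec (exists_twin I hj)

/-! ## The boundary of a twin-closed set -/

/-- The XOR pair lies in the variable set. -/
theorem xpair_subset_varSet (j : Fin m) : xpair I j ⊆ varSet I j := by
  intro u hu
  rcases (mem_xpair I).1 hu with rfl | rfl <;> exact mem_image.2 ⟨_, mem_univ _, rfl⟩

/-- An AND-read variable is read by every output with the same AND pair. -/
theorem mem_varSet_of_andEdge_eq {j j' : Fin m} (h : andEdge I j' = andEdge I j) {s : Fin 4} (hs : 2 ≤ s.val) :
    I.vars j s ∈ varSet I j' := by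
  have hmem : I.vars j s ∈ (andEdge I j : Sym2 (Fin n)) := by
    unfold PstarLinearisation.andEdge
    rw [Sym2.mem_iff]
    have : s = 2 ∨ s = 3 := by
      fin_cases s <;> simp at hs ⊢
    rcases this with rfl | rfl
    · exact Or.inl rfl
    · exact Or.inr rfl
  rw [← h] at hmem
  unfold PstarLinearisation.andEdge at hmem
  rcases Sym2.mem_iff.1 hmem with h' | h' <;> rw [h'] <;> exact mem_image.2 ⟨_, mem_univ _, rfl⟩

/-- **Boundary bound.**  For `S ⊆ repeated I` and `J = S ∪ twinOf(S)`: a boundary variable of `J` is an `x`-leaf of `S` or an XOR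
vertex of an output of `J ∖ S`. -/
theorem bdry_subset {S : Finset (Fin m)} (hS : S ⊆ repeated I) :
    bdry I (S ∪ S.image (twinOf I)) ⊆
      (univ.filter fun u => xdeg I S u = 1) ∪ ((S ∪ S.image (twinOf I)) \ S).biUnion (xpair I) := by
  classical
  set J := S ∪ S.image (twinOf I) with hJ
  intro u hu
  unfold PstarSALevel.bdry at hu
  rw [mem_filter] at hu
  obtain ⟨j₀, hj₀⟩ := card_eq_one.1 hu.2
  have hj₀m : j₀ ∈ J.filter (fun j => u ∈ varSet I j) := by rw [hj₀]; exact mem_singleton_self _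
  rw [mem_filter] at hj₀m
  obtain ⟨hj₀J, huj₀⟩ := hj₀m
  have huniq : ∀ j ∈ J, u ∈ varSet I j → j = j₀ := fun j hj hju => by
    have : j ∈ J.filter (fun j => u ∈ varSet I j) := mem_filter.2 ⟨hj, hju⟩
    rw [hj₀] at this
    exact mem_singleton.1 this
  -- a partner of `j₀` inside `J` with the same AND pair
  have hpartner : ∃ p ∈ J, p ≠ j₀ ∧ andEdge I p = andEdge I j₀ := by
    rcases mem_union.1 hj₀J with h | h
    · exact ⟨twinOf I j₀, mem_union_right _ (mem_image_of_mem _ h), (twinOf_spec I (hS h)).1, (twinOf_spec I (hS h)).2⟩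
    · obtain ⟨j₁, hj₁, rfl⟩ := mem_image.1 h
      exact ⟨j₁, mem_union_left _ hj₁, (twinOf_spec I (hS hj₁)).1.symm, (twinOf_spec I (hS hj₁)).2.symm⟩
  obtain ⟨p, hpJ, hpne, hpe⟩ := hpartner
  -- `u` is read by `j₀` in some slot `s`
  obtain ⟨s, -, hsu⟩ := mem_image.1 huj₀
  rcases Nat.lt_or_ge s.val 2 with hs | hs
  · -- an XOR slot: `u ∈ xpair j₀`
    have hux : u ∈ xpair I j₀ := by
      rw [mem_xpair]
      have : s = 0 ∨ s = 1 := by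
        fin_cases s <;> simp at hs ⊢
      rcases this with rfl | rfl
      · exact Or.inl hsu.symm
      · exact Or.inr hsu.symm
    by_cases hj₀S : j₀ ∈ S
    · refine mem_union_left _ (mem_filter.2 ⟨mem_univ _, ?_⟩)
      unfold PstarXCore.xdeg
      refine le_antisymm ?_ (card_pos.2 ⟨j₀, mem_filter.2 ⟨hj₀S, hux⟩⟩)
      rw [← hu.2]
      refine card_le_card (fun j hj => ?_)
      rw [mem_filter] at hj ⊢
      exact ⟨mem_union_left _ hj.1, xpair_subset_varSet I j hj.2⟩
    · exact mem_union_right _ (mem_biUnion.2 ⟨j₀, mem_sdiff.2 ⟨hj₀J, hj₀S⟩, hux⟩)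
  · -- an AND slot: the partner reads `u` as well — impossible
    exfalso
    have := mem_varSet_of_andEdge_eq I hpe hs
    rw [hsu] at this
    exact hpne (huniq p hpJ this)

/-- Its cardinality form: `|bdry J| ≤ #leaves(S) + 2·|J ∖ S|`. -/
theorem card_bdry_le {S : Finset (Fin m)} (hS : S ⊆ repeated I) :
    (bdry I (S ∪ S.image (twinOf I))).card ≤
      (univ.filter fun u => xdeg I S u = 1).card + 2 * ((S ∪ S.image (twinOf I)) \ S).card := by
  refine (card_le_card (bdry_subset I hS)).trans ((card_union_le _ _).trans (Nat.add_le_add_left ?_ _))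
  refine card_biUnion_le.trans ?_
  rw [mul_comm]
  exact sum_le_card_nsmul _ _ _ (fun j _ => card_xpair_le I j)

/-- `|J| = |S| + |J ∖ S|` and `|J ∖ S| ≤ |S|`. -/
theorem card_twinClosure (S : Finset (Fin m)) :
    (S ∪ S.image (twinOf I)).card = S.card + ((S ∪ S.image (twinOf I)) \ S).card ∧
      ((S ∪ S.image (twinOf I)) \ S).card ≤ S.card := by
  constructor
  · rw [← card_union_of_disjoint disjoint_sdiff, union_sdiff_of_subset subset_union_left]
  · rw [union_sdiff_left]
    exact (card_le_card sdiff_subset).trans card_image_le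

/-! ## The violating set -/

/-- **A small twin-closed set violating ratio `a/b`**: from `S ⊆ repeated I`, nonempty, with either no `x`-leaf, or at most two
`x`-leaves and at least `2b+1` outputs. -/
theorem violates {a b : ℕ} (hab : b < a) {S : Finset (Fin m)} (hS : S ⊆ repeated I) (hne : S.Nonempty)
    (hleaves : (univ.filter fun u => xdeg I S u = 1).card = 0 ∨
      ((univ.filter fun u => xdeg I S u = 1).card ≤ 2 ∧ 2 * b + 1 ≤ S.card)) :
    b * (bdry I (S ∪ S.image (twinOf I))).card < a * (S ∪ S.image (twinOf I)).card := by
  have h1 := card_bdry_le I hS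
  obtain ⟨h2, h3⟩ := card_twinClosure I S
  set t := ((S ∪ S.image (twinOf I)) \ S).card
  set L := (univ.filter fun u => xdeg I S u = 1).card
  have hs : 1 ≤ S.card := card_pos.2 hne
  have hbt : b * t ≤ b * S.card := Nat.mul_le_mul_left _ h3
  rw [h2]
  refine lt_of_le_of_lt (Nat.mul_le_mul_left _ h1) ?_
  have ha : (b + 1) * (S.card + t) ≤ a * (S.card + t) := Nat.mul_le_mul_right _ hab
  rcases hleaves with hL | ⟨hL, hsb⟩
  · rw [hL]; nlinarith
  · nlinarith

/-- **THE OBSTRUCTION.**  A linearisable pure `P⋆` instance is not `(r, a/b)`-boundary expanding for any `a > b` and any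
`r ≥ 4b + 2`.  (Restricted-model calibration of the range-avoidance ladder, ROUND-24; it says nothing about `P` versus `NP`.) -/
theorem linearisable_not_boundaryExpandingQ (hL : LinearisablePstar I) {a b r : ℕ} (hab : b < a) (hr : 4 * b + 2 ≤ r) :
    ¬BoundaryExpandingQ a b r I := by
  classical
  intro hBE
  have hinj : ∀ j, Function.Injective (I.vars j) := hL.1.2
  -- a nonempty leafless core inside the repeated outputs
  have hR := lt_card_repeated I hL
  have hcore : (xverts I (repeated I)).card < (repeated I).card :=
    lt_of_le_of_lt ((card_le_univ _).trans (by rw [Fintype.card_fin])) hR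
  obtain ⟨K, hKR, hKne, hKl⟩ := exists_leafless I (repeated I) hcore
  -- greedy: a path with `2b+1` edges or a small leafless set
  rcases path_or_small_leafless hinj hKne hKl (2 * b + 1) (by omega) with ⟨v, e, hp⟩ | ⟨S, hSK, hSne, hSl, hSc⟩
  · -- the path
    set S := (Finset.range (2 * b + 1)).image e with hSdef
    have hSK : S ⊆ K := by
      intro j hj
      obtain ⟨i, hi, rfl⟩ := mem_image.1 hj
      exact hp.2.2.1 i (mem_range.1 hi)
    have hScard : S.card = 2 * b + 1 := card_image_of_isXPath hp
    have hSne : S.Nonempty := card_pos.1 (by omega)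
    have hleaves : (univ.filter fun u => xdeg I S u = 1).card ≤ 2 := by
      refine (card_le_card (show (univ.filter fun u => xdeg I S u = 1) ⊆ {v 0, v (2 * b + 1)} from ?_)).trans
        (card_insert_le _ _ |>.trans (by rw [card_singleton]))
      intro u hu
      rw [mem_filter] at hu
      rw [mem_insert, mem_singleton]
      exact leaves_of_isXPath hp hu.2
    have hv := violates I hab (hSK.trans hKR) hSne (Or.inr ⟨hleaves, hScard.ge⟩)
    have hJ := hBE (S ∪ S.image (twinOf I)) (by
      obtain ⟨h2, h3⟩ := card_twinClosure I S; omega)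
    omega
  · -- the small leafless set
    have hleaves : (univ.filter fun u => xdeg I S u = 1).card = 0 := by
      rw [card_eq_zero, filter_eq_empty_iff]
      exact fun u _ => hSl u
    have hv := violates I hab (hSK.trans hKR) hSne (Or.inl hleaves)
    have hJ := hBE (S ∪ S.image (twinOf I)) (by
      obtain ⟨h2, h3⟩ := card_twinClosure I S; omega)
    omega

/-- In particular a linearisable pure `P⋆` instance is not `(r, 3/2)`-boundary expanding (`PstarSALevel.BoundaryExpanding`, the
R21 notion) for any `r ≥ 10`. -/
theorem linearisable_not_boundaryExpanding (hL : LinearisablePstar I) {r : ℕ} (hr : 10 ≤ r) :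
    ¬PstarSALevel.BoundaryExpanding r I := by
  rw [PstarSASDPLevel.boundaryExpanding_iff_Q]
  exact linearisable_not_boundaryExpandingQ I hL (by norm_num) (by omega)

end Summit.PneNP.PneNP.Theorems.PstarLinearisableNotExpanding
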